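import Mathlib.LinearAlgebra.Dual.Lemmas
import Mathlib.LinearAlgebra.FreeModule.PID
import Mathlib.LinearAlgebra.FreeModule.Finite.Matrix
import Mathlib.LinearAlgebra.Dimension.Localization
import Mathlib.LinearAlgebra.Dimension.RankNullity
import Mathlib.Algebra.Module.Projective
import Mathlib.RingTheory.PrincipalIdealDomain
import HarnessLib

/-!
# Saturated isotropic submodules of complementary rank are exact annihilators, and the dual
# quotient is saturated (pairings perfect modulo torsion over a principal ideal domain)

Topic `Algebra/Module` (theorems only; no definition, no named fact, no instance, no `sorry`).

Let `R` be a principal ideal domain (in the application: a discrete valuation ring `S_𝔮 = Λ/𝔮`,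
or `ℤ_p`), `X`, `Y` finitely generated `R`-modules and `B : X × Y → R` a bilinear pairing.  For
submodules `S ≤ X`, `S′ ≤ Y` write `ann_Y(S) = {y | B(S, y) = 0}`.  This file proves the module
algebra behind «the local conditions are everywhere exact orthogonal complements under the local
Tate pairing» for the compact modules of Howard 2004 (Def. 2.2.6 ff. / Lemma 3.1.1, arXiv:1202.6340
pp. 15–16) and Mazur–Rubin (*Kolyvagin systems*, §1.3), in the form consumed by the tree's tower file
`Literature/NumberTheory/EllipticCurves/TowerSaturatedAnnihilatorProofs.lean` (hypothesis (Exact)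
of `Tower.mem_levelCondition_of_forall_pairing_eq_zero`):

* §1 the formal core over a domain (`exists_sub_smul_mem_of_forall_mem_span`): if `ann_Y(S) ≤ S′`
  and every linear functional on `S` is represented by an element of `Y`, then
  «`B(S, x′) ⊆ (a)` ⇒ `x′ ∈ a • Y + S′`» — the functional `B(·, x′)|_S = a·ψ` and `ψ = B(·, y″)|_S`;
* §2 representability of the functionals on `S` (`exists_forall_pairing_eq_of_projective`): from the
  surjectivity of the adjoint `Y → Hom(X, R)` when `X/S` is projective (a complement of `S`), in
  particular when `X/S` is TORSION-FREE (= `S` saturated) and `X` is finitely generated over a PID;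
* §3 the exact annihilator (`mem_of_forall_pairing_eq_zero_of_finrank`): `ann_Y(S) = S′` as soon as
  `S ⊥ S′` (isotropy), `X/S` and `Y/S′` are torsion-free (saturation), the right kernel of `B` is
  torsion, and the ranks are complementary, `rank X = rank S + rank S′` (in the application: the
  Euler-characteristic count) — `ann_Y(S)` is the preimage of `ann(S) ≅ Hom(X/S, R)` under an adjoint
  with torsion kernel, so `rank ann_Y(S) ≤ rank X − rank S = rank S′`, and `ann_Y(S)/S′ ↪ Y/S′` is
  torsion-free of rank `0`;
* §4 the assembled statements (`exists_sub_smul_mem_of_isotropic_of_finrank`, both sides).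

References: B. Howard, Compositio Math. 140 (2004), H.4, Lemma 3.1.1, Def. 3.2.6 (arXiv:1202.6340
p. 7 L69–82, pp. 15–16); B. Mazur, K. Rubin, Mem. AMS 799 (2004), §1.3; J. S. Milne, *Arithmetic
Duality Theorems* (2006), I §0 and I Cor. 2.3; N. Bourbaki, *Algèbre* Ch. VII §4 (modules over
principal ideal domains: torsion-free finitely generated modules are free, saturated submodules are
direct factors).  BSD is not proved by any of this.
-/

noncomputable section

open Module Function

namespace Literature.Algebra.Module

variable {R : Type*} [CommRing R] {X Y : Type*} [AddCommGroup X] [Module R X]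
  [AddCommGroup Y] [Module R Y] (B : X →ₗ[R] Y →ₗ[R] R)

/-! ## §1 The formal core: `B(S, x′) ⊆ (a)` forces `x′ ∈ a • Y + S′` -/

/-- **The dual quotient is saturated** (formal core, any domain): if the annihilator of `S` in `Y`
lies in `S′` and every linear functional on `S` is of the form `B(·, y)|_S`, then an element `x′ ∈ Y`
pairing `S` into the principal ideal `(a)` is congruent modulo `S′` to an `a`-th multiple:
`x′ - a • y″ ∈ S′`.  (For `a ≠ 0` the functional `B(·, x′)|_S` is `a · ψ` with `ψ` linear by
cancellation; represent `ψ` by `y″`; then `B(S, x′ - a y″) = 0`.)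
[cite: MazurRubinMemoirs2004, §1.3 (local duality and exact orthogonal complements)]
[cite: Howard2004HeegnerKolyvagin, H.4 and Def. 3.2.6 (arXiv p. 7 L78–82, p. 16)] -/
theorem exists_sub_smul_mem_of_forall_mem_span [IsDomain R] (S : Submodule R X)
    (S' : Submodule R Y) (a : R)
    (hann : ∀ y : Y, (∀ s ∈ S, B s y = 0) → y ∈ S')
    (hrep : ∀ ψ : S →ₗ[R] R, ∃ y : Y, ∀ s : S, B s y = ψ s)
    (x' : Y) (hx' : ∀ s ∈ S, B s x' ∈ Ideal.span {a}) :
    ∃ y'' : Y, x' - a • y'' ∈ S' := by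
  by_cases ha : a = 0
  · refine ⟨0, ?_⟩
    rw [smul_zero, sub_zero]
    refine hann x' fun s hs ↦ ?_
    obtain ⟨c, hc⟩ := Ideal.mem_span_singleton'.1 (hx' s hs)
    rw [← hc, ha, mul_zero]
  · -- `B(s, x′) = r s * a` with `r` unique, hence linear
    choose r hr using fun s : S ↦ Ideal.mem_span_singleton'.1 (hx' s s.2)
    let ψ : S →ₗ[R] R :=
      { toFun := r
        map_add' := fun s t ↦ by
          apply mul_right_cancel₀ ha
          rw [hr, add_mul, hr, hr, Submodule.coe_add, map_add, LinearMap.add_apply]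
        map_smul' := fun c s ↦ by
          apply mul_right_cancel₀ ha
          rw [hr, RingHom.id_apply, smul_eq_mul, mul_assoc, hr, Submodule.coe_smul, map_smul,
            LinearMap.smul_apply, smul_eq_mul] }
    obtain ⟨y, hy⟩ := hrep ψ
    refine ⟨y, hann _ fun s hs ↦ ?_⟩
    have h1 : B s y = r ⟨s, hs⟩ := hy ⟨s, hs⟩
    have h2 : r ⟨s, hs⟩ * a = B s x' := hr ⟨s, hs⟩
    rw [map_sub, map_smul, smul_eq_mul, h1, ← h2, mul_comm, sub_self]

/-! ## §2 Representing the functionals on a saturated submodule -/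

/-- **Every linear functional on `S` is represented by `Y`** when the adjoint `Y → Hom(X, R)` is onto
and `X/S` is projective: a splitting `h` of `X → X/S` gives the projection `x ↦ x - h x̄` of `X` onto
`S`, along which functionals on `S` extend to `X`. [cite: MilneADT2006, Ch. I §0 (duality of finitely generated modules)]
[folklore: a projective quotient splits off] -/
theorem exists_forall_pairing_eq_of_projective (S : Submodule R X) [Module.Projective R (X ⧸ S)]
    (hsurj : ∀ Ψ : X →ₗ[R] R, ∃ y : Y, ∀ x : X, B x y = Ψ x) (ψ : S →ₗ[R] R) :
    ∃ y : Y, ∀ s : S, B s y = ψ s := by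
  obtain ⟨h, hh⟩ := Module.projective_lifting_property S.mkQ LinearMap.id S.mkQ_surjective
  have hmem : ∀ x : X, ((LinearMap.id : X →ₗ[R] X) - h ∘ₗ S.mkQ) x ∈ S := fun x ↦ by
    have hx := LinearMap.congr_fun hh (S.mkQ x)
    rw [LinearMap.comp_apply, LinearMap.id_apply] at hx
    rw [LinearMap.sub_apply, LinearMap.id_apply, LinearMap.comp_apply, ← Submodule.Quotient.mk_eq_zero,
      ← Submodule.mkQ_apply, map_sub, hx, sub_self]
  obtain ⟨y, hy⟩ :=
    hsurj (ψ ∘ₗ LinearMap.codRestrict S ((LinearMap.id : X →ₗ[R] X) - h ∘ₗ S.mkQ) hmem)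
  refine ⟨y, fun s ↦ ?_⟩
  rw [hy, LinearMap.comp_apply]
  congr 1
  apply Subtype.ext
  rw [LinearMap.codRestrict_apply, LinearMap.sub_apply, LinearMap.id_apply, LinearMap.comp_apply,
    Submodule.mkQ_apply, (Submodule.Quotient.mk_eq_zero S).2 s.2, map_zero, sub_zero]

/-- Over a principal ideal domain a SATURATED submodule of a finitely generated module (torsion-free
quotient) has a free, hence projective, quotient, so every functional on it is represented by `Y` as
soon as the adjoint `Y → Hom(X, R)` is onto. [cite: MilneADT2006, Ch. I §0]
[folklore: Bourbaki, Algèbre VII §4 — torsion-free finitely generated modules over a PID are free] -/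
theorem exists_forall_pairing_eq_of_isTorsionFree [IsDomain R] [IsPrincipalIdealRing R]
    [Module.Finite R X] (S : Submodule R X) [IsTorsionFree R (X ⧸ S)]
    (hsurj : ∀ Ψ : X →ₗ[R] R, ∃ y : Y, ∀ x : X, B x y = Ψ x) (ψ : S →ₗ[R] R) :
    ∃ y : Y, ∀ s : S, B s y = ψ s :=
  exists_forall_pairing_eq_of_projective B S hsurj ψ

/-! ## §3 Saturated isotropic submodules of complementary rank are exact annihilators -/

/-- **`ann_Y(S) = S′` for saturated, isotropic submodules of complementary rank** (pairing with
torsion right kernel over a PID): if `S ⊥ S′`, `X/S` and `Y/S′` are torsion-free, every `y` with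
`B(X, y) = 0` is torsion, and `rank X = rank S + rank S′`, then every `y ∈ Y` with `B(S, y) = 0` lies
in `S′`.  Proof: `ann_Y(S)` is the preimage under the adjoint `Y → Hom(X, R)` (torsion kernel) of
`ann(S) ≅ Hom(X/S, R)`, free of rank `rank X - rank S = rank S′`; so `S′ ≤ ann_Y(S)` have the same
rank and `ann_Y(S)/S′ ↪ Y/S′` is torsion-free of rank `0`, i.e. zero.
[cite: MazurRubinMemoirs2004, §1.3] [cite: MilneADT2006, Ch. I §0 Prop. 0.19 and Cor. 2.3]
[cite: Howard2004HeegnerKolyvagin, Lemma 3.1.1 and Def. 3.2.6 (arXiv pp. 15–16)] -/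
theorem mem_of_forall_pairing_eq_zero_of_finrank [IsDomain R] [IsPrincipalIdealRing R]
    [Module.Finite R X] [Module.Finite R Y] (S : Submodule R X) (S' : Submodule R Y)
    [IsTorsionFree R (X ⧸ S)] [IsTorsionFree R (Y ⧸ S')]
    (hiso : ∀ s ∈ S, ∀ s' ∈ S', B s s' = 0)
    (hker : ∀ y : Y, (∀ x : X, B x y = 0) → ∃ r : R, r ≠ 0 ∧ r • y = 0)
    (hrank : finrank R X = finrank R S + finrank R S')
    {y : Y} (hy : ∀ s ∈ S, B s y = 0) : y ∈ S' := by
  classical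
  -- the annihilator `A = ann_Y(S)` as the preimage of the dual annihilator of `S`
  let A : Submodule R Y := S.dualAnnihilator.comap B.flip
  have hA : ∀ z : Y, z ∈ A ↔ ∀ s ∈ S, B s z = 0 := fun z ↦ by
    simp only [A, Submodule.mem_comap, Submodule.mem_dualAnnihilator, LinearMap.flip_apply]
  have hS'A : S' ≤ A := fun z hz ↦ (hA z).2 fun s hs ↦ hiso s hs z hz
  have hyA : y ∈ A := (hA y).2 hy
  -- `rank ann(S) = rank Hom(X/S, R) = rank X - rank S = rank S′`
  haveI : Module.Finite R S.dualAnnihilator := Submodule.finite_dualAnnihilator_iff.2 inferInstance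
  have hdual : finrank R S.dualAnnihilator = finrank R S' := by
    rw [← S.dualQuotEquivDualAnnihilator.finrank_eq]
    change finrank R ((X ⧸ S) →ₗ[R] R) = _
    rw [Module.finrank_linearMap_self, Submodule.finrank_quotient, hrank, Nat.add_sub_cancel_left]
  -- `rank A ≤ rank S′`: the adjoint restricted to `A` has torsion kernel and range in `ann(S)`
  let g : A →ₗ[R] Module.Dual R X := B.flip ∘ₗ A.subtype
  have hg_range : LinearMap.range g ≤ S.dualAnnihilator := by
    rintro _ ⟨z, rfl⟩
    exact z.2
  have hg_ker : finrank R (LinearMap.ker g) = 0 := by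
    refine Module.finrank_eq_zero_iff.2 fun z ↦ ?_
    have hz : B.flip ((z : A) : Y) = 0 := (LinearMap.mem_ker).1 z.2
    obtain ⟨r, hr, hrz⟩ := hker ((z : A) : Y) fun x ↦ by
      rw [← LinearMap.flip_apply, hz, LinearMap.zero_apply]
    refine ⟨r, hr, Subtype.ext (Subtype.ext ?_)⟩
    simpa using hrz
  have hA_le : finrank R A ≤ finrank R S' := by
    have h1 := Submodule.finrank_quotient_add_finrank (LinearMap.ker g)
    rw [hg_ker, add_zero, g.quotKerEquivRange.finrank_eq] at h1
    rw [← h1, ← hdual]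
    exact Submodule.finrank_mono hg_range
  -- the map `A → Y/S′` has kernel `⊇ S′`, so its range has rank `0`; the range is torsion-free
  let q : A →ₗ[R] Y ⧸ S' := S'.mkQ ∘ₗ A.subtype
  have hq_ker : finrank R S' ≤ finrank R (LinearMap.ker q) := by
    have hle : S'.comap A.subtype ≤ LinearMap.ker q := fun z hz ↦ by
      rw [LinearMap.mem_ker]
      exact (Submodule.Quotient.mk_eq_zero S').2 hz
    calc finrank R S' = finrank R (S'.comap A.subtype) :=
        (Submodule.comapSubtypeEquivOfLe hS'A).finrank_eq.symm
      _ ≤ finrank R (LinearMap.ker q) := Submodule.finrank_mono hle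
  have hq_range : finrank R (LinearMap.range q) = 0 := by
    have h1 := Submodule.finrank_quotient_add_finrank (LinearMap.ker q)
    rw [q.quotKerEquivRange.finrank_eq] at h1
    omega
  have hq0 : Subsingleton (LinearMap.range q) := Module.finrank_zero_iff.1 hq_range
  have hqy : q ⟨y, hyA⟩ = 0 := by
    have h := Subsingleton.elim (⟨q ⟨y, hyA⟩, LinearMap.mem_range_self q _⟩ : LinearMap.range q)
      ⟨0, zero_mem _⟩
    exact congrArg Subtype.val h
  exact (Submodule.Quotient.mk_eq_zero S').1 hqy

/-- The annihilator characterisation `y ∈ S′ ↔ B(S, y) = 0` under the hypotheses of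
`mem_of_forall_pairing_eq_zero_of_finrank` (the `←` direction is isotropy).
[cite: MazurRubinMemoirs2004, §1.3] [cite: Howard2004HeegnerKolyvagin, H.4 (arXiv p. 7, L78–82)] -/
theorem mem_iff_forall_pairing_eq_zero_of_finrank [IsDomain R] [IsPrincipalIdealRing R]
    [Module.Finite R X] [Module.Finite R Y] (S : Submodule R X) (S' : Submodule R Y)
    [IsTorsionFree R (X ⧸ S)] [IsTorsionFree R (Y ⧸ S')]
    (hiso : ∀ s ∈ S, ∀ s' ∈ S', B s s' = 0)
    (hker : ∀ y : Y, (∀ x : X, B x y = 0) → ∃ r : R, r ≠ 0 ∧ r • y = 0)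
    (hrank : finrank R X = finrank R S + finrank R S') (y : Y) :
    y ∈ S' ↔ ∀ s ∈ S, B s y = 0 :=
  ⟨fun hy s hs ↦ hiso s hs y hy,
    fun hy ↦ mem_of_forall_pairing_eq_zero_of_finrank B S S' hiso hker hrank hy⟩

/-! ## §4 Assembly: the limit statement (Exact) of the tower file, on either side -/

/-- **The limit statement (Exact), right side.**  Over a PID, for finitely generated `X`, `Y`, a
pairing `B` whose right adjoint `Y → Hom(X, R)` is onto with torsion kernel (perfect modulo torsion
on the right), saturated isotropic submodules `S ≤ X`, `S′ ≤ Y` of complementary rank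
(`rank X = rank S + rank S′`): every `x′ ∈ Y` with `B(S, x′) ⊆ (a)` satisfies `x′ - a • y″ ∈ S′` for
some `y″` — with `a = p^k` this is hypothesis (Exact) of
`Tower.mem_levelCondition_of_forall_pairing_eq_zero` for the limit modules `lim_j H¹(K_v, T/p^j)`.
[cite: Howard2004HeegnerKolyvagin, H.4, Lemma 3.1.1 and Def. 3.2.6 (arXiv p. 7 L78–82, pp. 15–16)]
[cite: MazurRubinMemoirs2004, §1.3] [cite: MilneADT2006, Ch. I Cor. 2.3] -/
theorem exists_sub_smul_mem_of_isotropic_of_finrank [IsDomain R] [IsPrincipalIdealRing R]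
    [Module.Finite R X] [Module.Finite R Y] (S : Submodule R X) (S' : Submodule R Y)
    [IsTorsionFree R (X ⧸ S)] [IsTorsionFree R (Y ⧸ S')]
    (hiso : ∀ s ∈ S, ∀ s' ∈ S', B s s' = 0)
    (hker : ∀ y : Y, (∀ x : X, B x y = 0) → ∃ r : R, r ≠ 0 ∧ r • y = 0)
    (hsurj : ∀ Ψ : X →ₗ[R] R, ∃ y : Y, ∀ x : X, B x y = Ψ x)
    (hrank : finrank R X = finrank R S + finrank R S')
    (a : R) (x' : Y) (hx' : ∀ s ∈ S, B s x' ∈ Ideal.span {a}) :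
    ∃ y'' : Y, x' - a • y'' ∈ S' :=
  exists_sub_smul_mem_of_forall_mem_span B S S' a
    (fun _ hy ↦ mem_of_forall_pairing_eq_zero_of_finrank B S S' hiso hker hrank hy)
    (exists_forall_pairing_eq_of_isTorsionFree B S hsurj) x' hx'

/-- **The limit statement (Exact), left side** (the same for the flipped pairing): every `x ∈ X` with
`B(x, S′) ⊆ (a)` satisfies `x - a • x″ ∈ S` for some `x″`, given that the LEFT adjoint `X → Hom(Y, R)`
is onto with torsion kernel and `rank Y = rank S′ + rank S`.
[cite: Howard2004HeegnerKolyvagin, H.4 (arXiv p. 7, L78–82)] [cite: MazurRubinMemoirs2004, §1.3] -/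
theorem exists_sub_smul_mem_of_isotropic_of_finrank_left [IsDomain R] [IsPrincipalIdealRing R]
    [Module.Finite R X] [Module.Finite R Y] (S : Submodule R X) (S' : Submodule R Y)
    [IsTorsionFree R (X ⧸ S)] [IsTorsionFree R (Y ⧸ S')]
    (hiso : ∀ s ∈ S, ∀ s' ∈ S', B s s' = 0)
    (hker : ∀ x : X, (∀ y : Y, B x y = 0) → ∃ r : R, r ≠ 0 ∧ r • x = 0)
    (hsurj : ∀ Ψ : Y →ₗ[R] R, ∃ x : X, ∀ y : Y, B x y = Ψ y)
    (hrank : finrank R Y = finrank R S' + finrank R S)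
    (a : R) (x : X) (hx : ∀ s' ∈ S', B x s' ∈ Ideal.span {a}) :
    ∃ x'' : X, x - a • x'' ∈ S := by
  refine exists_sub_smul_mem_of_isotropic_of_finrank B.flip S' S (fun s' hs' s hs ↦ ?_)
    (fun x hx ↦ hker x fun y ↦ ?_) (fun Ψ ↦ ?_) hrank a x fun s' hs' ↦ ?_
  · rw [LinearMap.flip_apply]
    exact hiso s hs s' hs'
  · rw [← B.flip_apply]
    exact hx y
  · obtain ⟨x, hx⟩ := hsurj Ψ
    exact ⟨x, fun y ↦ by rw [LinearMap.flip_apply]; exact hx y⟩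
  · rw [LinearMap.flip_apply]
    exact hx s' hs'

end Literature.Algebra.Module

end
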